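import Mathlib.MeasureTheory.Integral.IntervalIntegral.FundThmCalculus
import Mathlib.Analysis.SpecialFunctions.Integrals.Basic
import Mathlib.Analysis.SpecialFunctions.Pow.Continuity
import Mathlib.Analysis.Calculus.MeanValue
import HarnessLib

/-!
# Vanishing of solutions at a regular singular point with dominant indicial exponent

Generic ODE input of the proof programme for the named fact
`Literature.Geometry.Lorentzian.Kerr.Costa2019_realAxisModeStability` (R. Teixeira da Costa,
Commun. Math. Phys. 378 (2020) 705–781 = arXiv:1910.02854 [Costa2019]): the injectivity of
Whiting's transform on mode solutions (Prop. 3.8 (4)) is reduced, via the non-vanishing leading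
coefficient of Lemma 3.14, to the following elementary uniqueness statement at the regular
singular point `r = r₊` of the confluent Heun equation. If `f` is `C¹` on `[x₀, x₀ + T]`,
`f(x₀) = 0`, and `(x − x₀) f'' + P f' + Q f = 0` on `(x₀, x₀ + T]` with `P, Q` continuous near
`[x₀, x₀ + T]`, `Re P ≥ c > 0` and `‖Q‖ T ≤ 1/2`, then `f ≡ 0` on `[x₀, x₀ + T]`
(`Costa2019.eq_zero_of_regularSingular`). Proof: with the integrating factor
`Pf(y) = exp(−∫_y^x P/(σ−x₀) dσ)` (`|Pf| ≤ 1`, `|Pf(x₀+ε)| ≤ (ε/t)^c`), `w = f'` satisfies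
`|w(x₀+t)| ≤ ‖Q‖ N t` whenever `|w| ≤ N`, so the bound halves; iterate. Everything is proved.

## References
* R. Teixeira da Costa, CMP 378 (2020) 705–781, arXiv:1910.02854, Prop. 3.8 (4), Lemma 3.14,
  (g-bdry-sub). [Costa2019]
-/

noncomputable section

open Complex Set MeasureTheory Filter Topology intervalIntegral

namespace Literature.Geometry.Lorentzian.Kerr

namespace Costa2019

/-- `‖exp(−z)‖ ≤ 1` when `0 ≤ Re z`, and `‖exp(−z)‖ ≤ exp(−m)` when `m ≤ Re z`. [folklore] -/
theorem norm_cexp_neg_le_exp_neg {z : ℂ} {m : ℝ} (hm : m ≤ z.re) :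
    ‖Complex.exp (-z)‖ ≤ Real.exp (-m) := by
  rw [Complex.norm_exp, Complex.neg_re]
  exact Real.exp_le_exp.2 (by linarith)

/-- **The halving step.** On `[x₀, x₀ + T]` let `f' = w`, `w' ` the derivative of `w` on
`(x₀, x₀+T]`, `(x − x₀) w' + P w + Q f = 0` there, `f(x₀) = 0`, `P, Q` continuous on an open
interval `(xₗ, xᵣ) ⊇ [x₀, x₀+T]`, `Re P ≥ c > 0`, `‖Q‖ ≤ B_Q`, `B_Q T ≤ 1/2`. If `‖w‖ ≤ N` on
`[x₀, x₀+T]` then `‖w‖ ≤ N/2` on `(x₀, x₀+T]`. [folklore] -/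
theorem regularSingular_halving {f w w' P Q : ℝ → ℂ} {xl xr x₀ T c BQ N : ℝ} (hT : 0 < T)
    (hxl : xl < x₀) (hxr : x₀ + T < xr)
    (hc : 0 < c) (hBQ : 0 ≤ BQ) (hBT : BQ * T ≤ 1 / 2) (hf0 : f x₀ = 0)
    (hf : ∀ x ∈ Icc x₀ (x₀ + T), HasDerivAt f (w x) x)
    (hw : ∀ x ∈ Ioc x₀ (x₀ + T), HasDerivAt w (w' x) x)
    (hP : ContinuousOn P (Ioo xl xr)) (hQ : ContinuousOn Q (Ioo xl xr))
    (hPc : ∀ x ∈ Icc x₀ (x₀ + T), c ≤ (P x).re) (hQB : ∀ x ∈ Icc x₀ (x₀ + T), ‖Q x‖ ≤ BQ)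
    (hode : ∀ x ∈ Ioc x₀ (x₀ + T), ((x - x₀ : ℝ) : ℂ) * w' x + P x * w x + Q x * f x = 0)
    (hN : ∀ x ∈ Icc x₀ (x₀ + T), ‖w x‖ ≤ N) :
    ∀ x ∈ Ioc x₀ (x₀ + T), ‖w x‖ ≤ N / 2 := by
  have hN0 : 0 ≤ N := (norm_nonneg _).trans (hN x₀ ⟨le_rfl, by linarith⟩)
  have hIccsub : Icc x₀ (x₀ + T) ⊆ Ioo xl xr := fun y hy => ⟨hxl.trans_le hy.1, hy.2.trans_lt hxr⟩
  have hfc : ContinuousOn f (Icc x₀ (x₀ + T)) := fun x hx => (hf x hx).continuousAt.continuousWithinAt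
  -- `|f(y)| ≤ N (y − x₀)` on `[x₀, x₀ + T]`
  have hfN : ∀ y ∈ Icc x₀ (x₀ + T), ‖f y‖ ≤ N * (y - x₀) := by
    intro y hy
    have hmvt := norm_image_sub_le_of_norm_deriv_le_segment' (f := f) (a := x₀) (b := x₀ + T)
      (fun x hx => (hf x hx).hasDerivWithinAt) (fun x hx => hN x (Ico_subset_Icc_self hx)) y hy
    rwa [hf0, sub_zero] at hmvt
  intro x hx
  set t : ℝ := x - x₀ with ht
  have ht0 : 0 < t := by rw [ht]; linarith [hx.1]
  -- the kernel `g(σ) = P(σ)/(σ − x₀)` of the integrating factor, continuous on `(x₀, xᵣ)`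
  set g : ℝ → ℂ := fun σ => P σ / ((σ - x₀ : ℝ) : ℂ) with hg
  have hopen : IsOpen (Ioo x₀ xr) := isOpen_Ioo
  have hgc : ContinuousOn g (Ioo x₀ xr) := by
    refine (hP.mono fun σ hσ => ⟨hxl.trans hσ.1, hσ.2⟩).div
      (Complex.continuous_ofReal.comp_continuousOn (continuousOn_id.sub continuousOn_const)) ?_
    intro σ hσ
    exact_mod_cast (ne_of_gt (sub_pos.2 hσ.1))
  have hgre : ∀ σ, x₀ < σ → σ ≤ x₀ + T → c / (σ - x₀) ≤ (g σ).re := by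
    intro σ hσ1 hσ2
    have hσ0 : 0 < σ - x₀ := sub_pos.2 hσ1
    have : (g σ).re = (P σ).re / (σ - x₀) := by
      show (P σ / ((σ - x₀ : ℝ) : ℂ)).re = (P σ).re / (σ - x₀)
      rw [Complex.div_ofReal_re]
    rw [this]
    exact div_le_div_of_nonneg_right (hPc σ ⟨hσ1.le, hσ2⟩) hσ0.le
  -- the estimate with the integrating factor started at `x₀ + ε`
  have hkey : ∀ ε, 0 < ε → ε < t → ‖w x‖ ≤ (ε / t) ^ c * N + BQ * N * t := by
    intro ε hε hεt
    set aε : ℝ := x₀ + ε with haε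
    have haε1 : x₀ < aε := by rw [haε]; linarith
    have haε2 : aε < x := by rw [haε]; linarith
    have hmemI : ∀ y ∈ Icc aε x, y ∈ Ioo x₀ xr := fun y hy =>
      ⟨haε1.trans_le hy.1, (hy.2.trans hx.2).trans_lt hxr⟩
    have hmemT : ∀ y ∈ Icc aε x, y ∈ Ioc x₀ (x₀ + T) := fun y hy =>
      ⟨haε1.trans_le hy.1, hy.2.trans hx.2⟩
    -- `F(y) = ∫_y^x g` and the integrating factor `Pf = exp(−F)`
    have hgi : ∀ y ∈ Icc aε x, IntervalIntegrable g volume y x := by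
      intro y hy
      refine (hgc.mono fun σ hσ => ?_).intervalIntegrable
      rw [uIcc_of_le hy.2] at hσ
      exact ⟨(haε1.trans_le hy.1).trans_le hσ.1, (hσ.2.trans hx.2).trans_lt hxr⟩
    have hFd : ∀ y ∈ Icc aε x, HasDerivAt (fun u => ∫ σ in u..x, g σ) (-g y) y := by
      intro y hy
      exact integral_hasDerivAt_left (hgi y hy) (hgc.stronglyMeasurableAtFilter hopen _ (hmemI y hy))
        (hgc.continuousAt (hopen.mem_nhds (hmemI y hy)))
    set Pf : ℝ → ℂ := fun y => Complex.exp (-(∫ σ in y..x, g σ)) with hPf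
    have hPfd : ∀ y ∈ Icc aε x, HasDerivAt Pf (Pf y * g y) y := by
      intro y hy
      have h1 := ((hFd y hy).neg).cexp
      refine h1.congr_deriv ?_
      simp only [hPf, Pi.neg_apply, neg_neg]
    have hPfx : Pf x = 1 := by simp [hPf]
    -- `|Pf| ≤ 1` on `[aε, x]`
    have hre_int : ∀ y ∈ Icc aε x, (∫ σ in y..x, g σ).re = ∫ σ in y..x, (g σ).re := by
      intro y hy
      have := intervalIntegral_re (hgi y hy)
      simpa using this.symm
    have hPfle : ∀ y ∈ Icc aε x, ‖Pf y‖ ≤ 1 := by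
      intro y hy
      have h0 : (0 : ℝ) ≤ (∫ σ in y..x, g σ).re := by
        rw [hre_int y hy]
        refine intervalIntegral.integral_nonneg hy.2 fun σ hσ => ?_
        have h1 := hgre σ ((haε1.trans_le hy.1).trans_le hσ.1) (hσ.2.trans hx.2)
        exact le_trans (div_nonneg hc.le (by linarith [(haε1.trans_le hy.1).trans_le hσ.1])) h1
      have := norm_cexp_neg_le_exp_neg h0
      simpa using this
    -- `|Pf(aε)| ≤ (ε/t)^c`
    have hPfa : ‖Pf aε‖ ≤ (ε / t) ^ c := by
      have hlog : ∫ σ in aε..x, c / (σ - x₀) = c * Real.log (t / ε) := by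
        have h1 : ∫ σ in aε..x, c / (σ - x₀) = ∫ u in ε..t, c / u := by
          have := intervalIntegral.integral_comp_sub_right (fun u => c / u) x₀ (a := aε) (b := x)
          rw [show aε - x₀ = ε by rw [haε]; ring, show x - x₀ = t by rw [ht]] at this
          exact this
        rw [h1]
        have h2 : ∫ u in ε..t, c / u = c * ∫ u in ε..t, u⁻¹ := by
          rw [← intervalIntegral.integral_const_mul]
          refine intervalIntegral.integral_congr fun u _ => ?_
          simp [div_eq_mul_inv]
        rw [h2, integral_inv_of_pos hε ht0]
      have hmono : c * Real.log (t / ε) ≤ (∫ σ in aε..x, g σ).re := by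
        rw [hre_int aε ⟨le_rfl, haε2.le⟩, ← hlog]
        refine intervalIntegral.integral_mono_on haε2.le ?_ ?_ fun σ hσ => ?_
        · refine (continuousOn_const.div (continuousOn_id.sub continuousOn_const) ?_).intervalIntegrable_of_Icc haε2.le
          intro σ hσ; exact ne_of_gt (sub_pos.2 (haε1.trans_le hσ.1))
        · refine (Complex.continuous_re.comp_continuousOn (hgc.mono fun σ hσ => ?_)).intervalIntegrable_of_Icc haε2.le
          exact ⟨haε1.trans_le hσ.1, (hσ.2.trans hx.2).trans_lt hxr⟩
        · exact hgre σ (haε1.trans_le hσ.1) (hσ.2.trans hx.2)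
      calc ‖Pf aε‖ ≤ Real.exp (-(c * Real.log (t / ε))) := norm_cexp_neg_le_exp_neg hmono
        _ = (ε / t) ^ c := by
            rw [Real.rpow_def_of_pos (div_pos hε ht0), ← Real.exp_log (div_pos ht0 hε)]
            rw [Real.log_exp, Real.log_div ht0.ne' hε.ne', Real.log_div hε.ne' ht0.ne']
            congr 1; ring
    -- `G = Pf w` and its derivative `−Pf Q f/(y − x₀)`
    set G' : ℝ → ℂ := fun y => -(Pf y * Q y * f y / ((y - x₀ : ℝ) : ℂ)) with hG'
    have hGd : ∀ y ∈ Icc aε x, HasDerivAt (fun y => Pf y * w y) (G' y) y := by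
      intro y hy
      have hy0 : ((y - x₀ : ℝ) : ℂ) ≠ 0 := by exact_mod_cast (ne_of_gt (sub_pos.2 (haε1.trans_le hy.1)))
      have h1 := (hPfd y hy).mul (hw y (hmemT y hy))
      refine h1.congr_deriv ?_
      have hode' := hode y (hmemT y hy)
      simp only [hG', hg]
      field_simp
      linear_combination (Pf y) * hode'
    have hG'c : ContinuousOn G' (Icc aε x) := by
      have hPfc : ContinuousOn Pf (Icc aε x) := fun y hy => (hPfd y hy).continuousAt.continuousWithinAt
      have hden : Continuous fun y : ℝ => ((y - x₀ : ℝ) : ℂ) :=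
        Complex.continuous_ofReal.comp (continuous_id.sub continuous_const)
      refine ((((hPfc.mul (hQ.mono fun y hy => ⟨hxl.trans (hmemI y hy).1, (hmemI y hy).2⟩)).mul
        (hfc.mono fun y hy => Ioc_subset_Icc_self (hmemT y hy))).div hden.continuousOn
        fun y hy => ?_)).neg
      exact_mod_cast (ne_of_gt (sub_pos.2 (haε1.trans_le hy.1)))
    have hFTC : ∫ y in aε..x, G' y = Pf x * w x - Pf aε * w aε :=
      integral_eq_sub_of_hasDerivAt (fun y hy => hGd y (by rwa [uIcc_of_le haε2.le] at hy))
        (hG'c.intervalIntegrable_of_Icc haε2.le)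
    -- size of `∫ G'`
    have hG'b : ∀ y ∈ Set.uIoc aε x, ‖G' y‖ ≤ BQ * N := by
      intro y hy
      rw [uIoc_of_le haε2.le] at hy
      have hy' : y ∈ Icc aε x := ⟨hy.1.le, hy.2⟩
      have hyx₀ : 0 < y - x₀ := sub_pos.2 (haε1.trans hy.1)
      rw [hG', norm_neg, norm_div, norm_mul, norm_mul, Complex.norm_real, Real.norm_eq_abs,
        abs_of_pos hyx₀, div_le_iff₀ hyx₀]
      have h1 := hPfle y hy'
      have h2 := hQB y ⟨(haε1.trans hy.1).le, hy.2.trans hx.2⟩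
      have h3 := hfN y ⟨(haε1.trans hy.1).le, hy.2.trans hx.2⟩
      calc ‖Pf y‖ * ‖Q y‖ * ‖f y‖ ≤ 1 * BQ * (N * (y - x₀)) :=
            mul_le_mul (mul_le_mul h1 h2 (norm_nonneg _) zero_le_one) h3 (norm_nonneg _)
              (by positivity)
        _ = BQ * N * (y - x₀) := by ring
    have hint : ‖∫ y in aε..x, G' y‖ ≤ BQ * N * |x - aε| := norm_integral_le_of_norm_le_const hG'b
    -- assemble
    have hxa : |x - aε| ≤ t := by rw [abs_of_pos (sub_pos.2 haε2), haε, ht]; linarith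
    calc ‖w x‖ = ‖Pf x * w x‖ := by rw [hPfx, one_mul]
      _ = ‖Pf aε * w aε + ∫ y in aε..x, G' y‖ := by rw [hFTC]; ring_nf
      _ ≤ ‖Pf aε * w aε‖ + ‖∫ y in aε..x, G' y‖ := norm_add_le _ _
      _ ≤ (ε / t) ^ c * N + BQ * N * t := by
          refine add_le_add ?_ (hint.trans (mul_le_mul_of_nonneg_left hxa (by positivity)))
          rw [norm_mul]
          exact mul_le_mul hPfa (hN aε ⟨haε1.le, haε2.le.trans hx.2⟩) (norm_nonneg _)
            (Real.rpow_nonneg (div_pos hε ht0).le _)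
  -- let `ε → 0`
  have hlim : Tendsto (fun ε : ℝ => (ε / t) ^ c * N + BQ * N * t) (𝓝[>] 0) (𝓝 (BQ * N * t)) := by
    have h1 : Tendsto (fun ε : ℝ => (ε / t) ^ c) (𝓝 0) (𝓝 0) := by
      have hcont : Continuous fun ε : ℝ => (ε / t) ^ c :=
        (continuous_id.div_const t).rpow_const fun _ => Or.inr hc.le
      have := hcont.tendsto 0
      simpa [Real.zero_rpow hc.ne'] using this
    have h2 := ((h1.mul_const N).add_const (BQ * N * t)).mono_left (nhdsWithin_le_nhds (s := Ioi (0:ℝ)))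
    simpa using h2
  have hev : ∀ᶠ ε in 𝓝[>] (0 : ℝ), ‖w x‖ ≤ (ε / t) ^ c * N + BQ * N * t := by
    filter_upwards [Ioo_mem_nhdsGT ht0] with ε hε using hkey ε hε.1 hε.2
  have hfinal : ‖w x‖ ≤ BQ * N * t := ge_of_tendsto hlim hev
  have htT : t ≤ T := by rw [ht]; linarith [hx.2]
  calc ‖w x‖ ≤ BQ * N * t := hfinal
    _ ≤ BQ * N * T := mul_le_mul_of_nonneg_left htT (by positivity)
    _ = (BQ * T) * N := by ring
    _ ≤ (1 / 2) * N := mul_le_mul_of_nonneg_right hBT hN0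
    _ = N / 2 := by ring

/-- **Vanishing at a regular singular point with dominant exponent.** In the setting of
`regularSingular_halving` (without the a priori bound `N`): `f ≡ 0` on `[x₀, x₀ + T]`, provided
`w = f'` is continuous on `[x₀, x₀ + T]`. [cite: Costa2019, Prop. 3.8 (4) (injectivity), Lemma 3.14] -/
theorem eq_zero_of_regularSingular {f w w' P Q : ℝ → ℂ} {xl xr x₀ T c BQ : ℝ} (hT : 0 < T)
    (hxl : xl < x₀) (hxr : x₀ + T < xr)
    (hc : 0 < c) (hBQ : 0 ≤ BQ) (hBT : BQ * T ≤ 1 / 2) (hf0 : f x₀ = 0)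
    (hf : ∀ x ∈ Icc x₀ (x₀ + T), HasDerivAt f (w x) x)
    (hw : ∀ x ∈ Ioc x₀ (x₀ + T), HasDerivAt w (w' x) x)
    (hwc : ContinuousOn w (Icc x₀ (x₀ + T)))
    (hP : ContinuousOn P (Ioo xl xr)) (hQ : ContinuousOn Q (Ioo xl xr))
    (hPc : ∀ x ∈ Icc x₀ (x₀ + T), c ≤ (P x).re) (hQB : ∀ x ∈ Icc x₀ (x₀ + T), ‖Q x‖ ≤ BQ)
    (hode : ∀ x ∈ Ioc x₀ (x₀ + T), ((x - x₀ : ℝ) : ℂ) * w' x + P x * w x + Q x * f x = 0) :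
    ∀ x ∈ Icc x₀ (x₀ + T), f x = 0 := by
  -- an initial bound
  obtain ⟨N₀, hN₀⟩ := isCompact_Icc.exists_bound_of_continuousOn hwc
  -- closure step at `x₀`
  have hclos : ∀ B : ℝ, (∀ x ∈ Ioc x₀ (x₀ + T), ‖w x‖ ≤ B) → ∀ x ∈ Icc x₀ (x₀ + T), ‖w x‖ ≤ B := by
    intro B hB x hx
    rcases eq_or_lt_of_le hx.1 with h | h
    · rw [← h]
      have hne : (𝓝[Ioc x₀ (x₀ + T)] x₀).NeBot := by
        refine mem_closure_iff_nhdsWithin_neBot.1 ?_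
        rw [closure_Ioc (by linarith : x₀ ≠ x₀ + T)]
        exact ⟨le_rfl, by linarith⟩
      have ht : Tendsto (fun y => ‖w y‖) (𝓝[Ioc x₀ (x₀ + T)] x₀) (𝓝 ‖w x₀‖) :=
        ((hwc x₀ ⟨le_rfl, by linarith⟩).mono Ioc_subset_Icc_self).norm.tendsto
      exact le_of_tendsto ht (eventually_nhdsWithin_of_forall hB)
    · exact hB x ⟨h, hx.2⟩
  -- iterate the halving
  have hiter : ∀ k : ℕ, ∀ x ∈ Icc x₀ (x₀ + T), ‖w x‖ ≤ N₀ / 2 ^ k := by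
    intro k
    induction k with
    | zero => simpa using hN₀
    | succ k ih =>
      have h := regularSingular_halving hT hxl hxr hc hBQ hBT hf0 hf hw hP hQ hPc hQB hode ih
      have h' : ∀ x ∈ Ioc x₀ (x₀ + T), ‖w x‖ ≤ N₀ / 2 ^ (k + 1) := fun x hx => by
        rw [pow_succ, ← div_div]; exact h x hx
      exact hclos _ h'
  -- hence `w ≡ 0`
  have hw0 : ∀ x ∈ Icc x₀ (x₀ + T), w x = 0 := by
    intro x hx
    have hlim : Tendsto (fun k : ℕ => N₀ / 2 ^ k) atTop (𝓝 0) := by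
      have := tendsto_pow_atTop_nhds_zero_of_lt_one (r := (1 / 2 : ℝ)) (by norm_num) (by norm_num)
      have h2 := this.const_mul N₀
      simp only [mul_zero] at h2
      refine h2.congr fun k => ?_
      rw [one_div, inv_pow, div_eq_mul_inv]
    have h0 : ‖w x‖ ≤ 0 := ge_of_tendsto hlim (Eventually.of_forall fun k => hiter k x hx)
    exact norm_le_zero_iff.1 h0
  -- and `f ≡ 0`
  intro x hx
  have hmvt := norm_image_sub_le_of_norm_deriv_le_segment' (f := f) (a := x₀) (b := x₀ + T) (C := 0)
    (fun y hy => (hf y hy).hasDerivWithinAt) (fun y hy => by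
      rw [hw0 y (Ico_subset_Icc_self hy), norm_zero]) x hx
  rw [hf0, sub_zero, zero_mul] at hmvt
  exact norm_le_zero_iff.1 hmvt

end Costa2019

end Literature.Geometry.Lorentzian.Kerr

end
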